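/-
Copyright: statement-level skeleton of a published paper (lit-balaban cell, Phase-2 proof seat p25, gen 22). No proof
claims beyond what the kernel checks below.
-/
import Literature.MathematicalPhysics.QuantumFieldTheory.BalabanImbrieJaffe1984to88.BIJ88WalkSplit245Letters

/-!
# `BalabanImbrieJaffe1984to88.BIJ88WalkSplit245LettersDecay` — T. Bałaban, J. Imbrie, A. Jaffe, *Effective action and
cluster properties of the abelian Higgs model*, Commun. Math. Phys. **114** (1988) 257–315 [BalabanImbrieJaffe1988],
Sect. 2 p. 264 [PDF 8], verbatim: *"a random walk expansion as in [6] can be used to prove that |C^{(k)}_Λ(u; x₁, x₂)|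
≦ ce^{−c|x₁−x₂|}. (2.41) … The local part C^{(k)}_{Λ,loc}(u; x₁, x₂) depends only on u in an O(r(e_k)) neighborhood of
x₁, x₂; it vanishes for |x₁ − x₂| > ½r(e_k) and is bounded as in (2.41)."* with §5.14 p. 310 [PDF 54]: *"The leading
terms, with only propagators C^{(k)}_{Λ₁₂^{(k)},loc}, C^{(k)}_{Λ₁₂^{(k)},loc}(u_{k+1}), we transform further. The others,
localized in region X, have a factor of e^{−cr(e_k)|X|}."* — **THE LOCAL LETTER OF PRINT'S SPLIT FROM THE DECAY
(2.41)** (p25 gen 22; file W6a′, a MEMBER of row C2.Claim@312, owner r16, referee ref-5; companion of W6a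
`BIJ88WalkSplit245Letters`; the head of record and every earlier file UNCHANGED).

W6a derived the local clause letter as `B′_loc = E_loc·D·s_c·R₁K_w` from an ENTRYWISE bound `E_loc` and the finite
range — a letter that grows with the number `s_c` of sites per `r(e_k)`-cube.  Print's *"bounded as in (2.41)"* is
stronger: the kernel DECAYS, `|C_loc(x₁,x₂)| ≤ K₀e^{−c₁|x₁−x₂|}`, so its column sums are bounded by `K₀` times a lattice
sum `Σ_x e^{−c₁|x−y|} ≤ C_s` that does not see `r(e_k)` at all.  Here: §1 `colsum_le_of_decay` ([folklore]: decay +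
summability of the profile ⇒ column sums `≤ K₀C_s`); §2 **`split245_letters_of_colsum`** — W6a's seven clause inputs
with the local column-sum letter `C_ℓ` as an INPUT (`B′_loc = C_ℓ·R₁K_w`, condition `C_ℓ·R₁K_w ≤ B_ℓ`; the region
pieces exactly as in W6a), of which W6a's `split245_letters` is the instance `C_ℓ = E_loc·D·s_c` and §3
**`split245_letters_decay`** the instance `C_ℓ = K₀·C_s` (decay letter `K₀, c₁` + site-summability letter `C_s`; in
[6]'s setting `K₀ = (s₀A/(1 − Dβ))e^{2δb₀/μ}`, `c₁ = δ/μ` by p02's `BIJ88Decay241Walks.abs_cLoc_le_exp`).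

statement-level skeleton of published theorems with citation tags; proofs where landed; nothing here is a claim
about the Yang–Mills mass gap

PDF held: `paper:balaban1988-cmp114-bij-abelian-higgs-effective-action` (journal page = PDF page + 256); p. 264 = PDF
8, p. 310 = PDF 54.

CITATION HEADER (lean-in-tree rule).  lit-balaban cell (HOME `run/shared/lean/pub/lit-balaban/`), Phase 2, seat p25
gen 22; row **C2.Claim@312** of `HOME/lit-balaban-r16/ROWS-C2-part2.md` (owner r16, referee ref-5; MEMBER); reader
edge to row C2.Eq2.41 (owner r18).  USED BY NAME, nothing restated: `BIJ88WalkSplit245Letters.{letters_of_colsum,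
colsum_cX_le}` (W6a), `BIJ88RandomWalk242.{cLoc, cX, memX, closure}` (p13), `BIJ88Sect2Statements.Ineq246` (r18),
`BIJ88WalkProductCutoffVolFree312.sum_abs_mulVec_le` (N4, through W6a).

## What is proved (0 `sorry`, standard axioms, no new `Prop` facts; theorems only, no definitions)

* §1 `colsum_le_of_decay`; §2 **`split245_letters_of_colsum`**; §3 **`split245_letters_decay`**.
HONEST SCOPE: as W6a; the site-summability letter `C_s` (a lattice constant: `Σ_x e^{−c₁ d(x,y)} ≤ C_s`) is a
HYPOTHESIS on the site metric, not derived here.  NOT summit progress; NOT continuum; NOT Clay.  Imports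
`BIJ88WalkSplit245Letters`; modifies nothing.
-/

noncomputable section

namespace Literature.MathematicalPhysics.QuantumFieldTheory.BalabanImbrieJaffe1984to88.BIJ88WalkSplit245LettersDecay

open Classical Matrix Finset
open scoped BigOperators
open BIJ88RandomWalk242
open BIJ88WalkSplit245Letters (letters_of_colsum colsum_cX_le)

/-! ## §1  Decay and summability of the profile ⇒ column sums -/

section Generic

variable {S : Type} [Fintype S]

/-- **COLUMN SUMS FROM DECAY**: `|C_{xy}| ≤ K₀e^{−c₁d(x,y)}` and `Σ_x e^{−c₁d(x,y)} ≤ C_s` give `Σ_x|C_{xy}| ≤ K₀·C_s`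
(*"bounded as in (2.41)"* read in the `ℓ¹` currency). [folklore] [cite: BalabanImbrieJaffe1988, (2.41) p.264] -/
theorem colsum_le_of_decay (C : Matrix S S ℝ) (d : S → S → ℝ) {K₀ c₁ Cs : ℝ} (hK0 : 0 ≤ K₀)
    (hdec : ∀ x y, |C x y| ≤ K₀ * Real.exp (-(c₁ * d x y)))
    (hsum : ∀ y, ∑ x, Real.exp (-(c₁ * d x y)) ≤ Cs) (y : S) : ∑ x, |C x y| ≤ K₀ * Cs :=
  calc ∑ x, |C x y| ≤ ∑ x, K₀ * Real.exp (-(c₁ * d x y)) := Finset.sum_le_sum fun x _ => hdec x y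
    _ = K₀ * ∑ x, Real.exp (-(c₁ * d x y)) := by rw [Finset.mul_sum]
    _ ≤ K₀ * Cs := mul_le_mul_of_nonneg_left (hsum y) hK0

end Generic

/-! ## §2  The seven clause inputs with the local column-sum letter as an input -/

section Split

variable {J S K : Type} [DecidableEq J] [Fintype S] [Fintype K] [DecidableEq K]

/-- `e^{−a·m}·m ≤ e^{−a}` for `a ≥ 1` and `m ≥ 1` (bookkeeping, as in W6a). [folklore] -/
private theorem exp_neg_pow_mul_le {a : ℝ} (ha : 1 ≤ a) {m : ℕ} (hm : 1 ≤ m) :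
    Real.exp (-a) ^ m * m ≤ Real.exp (-a) := by
  obtain ⟨n, rfl⟩ : ∃ n, m = n + 1 := ⟨m - 1, by omega⟩
  have h1 : Real.exp (-a) ^ n ≤ Real.exp (-1) ^ n :=
    pow_le_pow_left₀ (Real.exp_pos _).le (Real.exp_le_exp.mpr (by linarith)) n
  have h2 : Real.exp (-1) ^ n * ((n : ℝ) + 1) ≤ 1 := by
    rw [← Real.exp_nat_mul, mul_neg, mul_one]
    calc Real.exp (-(n : ℝ)) * ((n : ℝ) + 1) ≤ Real.exp (-(n : ℝ)) * Real.exp n :=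
          mul_le_mul_of_nonneg_left (Real.add_one_le_exp _) (Real.exp_pos _).le
      _ = 1 := by rw [← Real.exp_add, neg_add_cancel, Real.exp_zero]
  push_cast
  calc Real.exp (-a) ^ (n + 1) * ((n : ℝ) + 1) = Real.exp (-a) * (Real.exp (-a) ^ n * ((n : ℝ) + 1)) := by ring
    _ ≤ Real.exp (-a) * (Real.exp (-1) ^ n * ((n : ℝ) + 1)) :=
        mul_le_mul_of_nonneg_left (mul_le_mul_of_nonneg_right h1 (by positivity)) (Real.exp_pos _).le
    _ ≤ Real.exp (-a) * 1 := mul_le_mul_of_nonneg_left h2 (Real.exp_pos _).le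
    _ = Real.exp (-a) := mul_one _

/-- **THE SEVEN CLAUSE INPUTS OF THE HEAD FOR PRINT'S SPLIT, LOCAL COLUMN-SUM LETTER AS INPUT**: as W6a's
`split245_letters` (family `none ↦ C_loc`, `some X ↦ C_X` over an admissible subtype of regions; `trig = isSome`;
`ρ_loc = 1`, `ρ_X = λ^{|X|}`, `λ = e^{−c·r(e_k)/2}`; `B′_X = λ^{|X|}·|X|·s_c·R₁K_w`) but with the local piece entering
only through `C_ℓ`, a bound on its column sums `Σ_x|C_loc(x,y)| ≤ C_ℓ`: `B′_loc = C_ℓ·R₁K_w`, condition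
`C_ℓ·R₁K_w ≤ B_ℓ` (`K_w = R_∞ + ‖f‖_∞ + 1`).  Region inputs as in W6a: the typed row (2.46), `≤ s_c` sites per cube,
`4 ≤ c·r(e_k)`, `e^{−c·r(e_k)/4} ≤ θ`, `e^{−c·r(e_k)/4}·s_c·R₁K_w ≤ θ_w`.
[cite: BalabanImbrieJaffe1988, §5.14 p.310, p.312 (estimate preceding (5.14.5)); (2.41), (2.43)-(2.46) p.264] -/
theorem split245_letters_of_colsum (ldist : J → S → ℝ) (ρr : ℝ) (cubeOf : J → K) (cadj : K → K → Prop)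
    (Cw : Walk J → S → S → ℝ) (inBlock : S → J → Prop) (cube : S → K) (Adm : Finset K → Prop) {c rek : ℝ}
    (h246 : BIJ88Sect2Statements.Ineq246 (fun X : Finset K => X.card) (memX inBlock cubeOf cadj)
      (cX ldist ρr cubeOf cadj Cw) c rek)
    (hblk : ∀ x j, inBlock x j → cube x ∈ closure cadj {cubeOf j})
    {Cl : ℝ} (hCl0 : 0 ≤ Cl) (hCl : ∀ y, ∑ x, |cLoc ldist ρr Cw x y| ≤ Cl) {sc : ℕ}
    (hsc : ∀ k, (univ.filter fun x => cube x = k).card ≤ sc)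
    {B : Type} (Bs : Finset B) {y : B → S} (hy : Set.InjOn y Bs) (f : S → ℝ)
    {Dir : Set (S → ℝ)} {Rinf R1 : ℝ} (hRinf : 0 ≤ Rinf) (hR1 : 0 ≤ R1)
    (hDir : ∀ u ∈ Dir, ‖u‖ ≤ Rinf ∧ ∑ x, |u x| ≤ R1)
    {θ θw Bl : ℝ} (h4 : 4 ≤ c * rek) (hθrek : Real.exp (-(c * rek / 4)) ≤ θ)
    (hBl' : Cl * (R1 * (Rinf + ‖f‖ + 1)) ≤ Bl)
    (hθw' : Real.exp (-(c * rek / 4)) * sc * (R1 * (Rinf + ‖f‖ + 1)) ≤ θw) :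
    (∀ p : Option {X : Finset K // Adm X}, 0 ≤ (Option.elim p (Cl * (R1 * (Rinf + ‖f‖ + 1)))
        fun r => Real.exp (-(c * rek / 2)) ^ r.1.card * ((r.1.card * sc : ℕ) : ℝ) * (R1 * (Rinf + ‖f‖ + 1)) : ℝ)) ∧
    (∀ p : Option {X : Finset K // Adm X}, 0 ≤ (Option.elim p 1 fun r => Real.exp (-(c * rek / 2)) ^ r.1.card : ℝ)) ∧
    (∀ p : Option {X : Finset K // Adm X}, ∀ u ∈ Dir, ∀ w ∈ Dir,
      |((Option.elim p (cLoc ldist ρr Cw) fun r => cX ldist ρr cubeOf cadj Cw r.1 : Matrix S S ℝ) *ᵥ u) ⬝ᵥ w|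
        ≤ (Option.elim p (Cl * (R1 * (Rinf + ‖f‖ + 1)))
            fun r => Real.exp (-(c * rek / 2)) ^ r.1.card * ((r.1.card * sc : ℕ) : ℝ) * (R1 * (Rinf + ‖f‖ + 1)) : ℝ)
          * (Option.elim p 1 fun r => Real.exp (-(c * rek / 2)) ^ r.1.card : ℝ)) ∧
    (∀ p : Option {X : Finset K // Adm X}, ∀ u ∈ Dir,
      |((Option.elim p (cLoc ldist ρr Cw) fun r => cX ldist ρr cubeOf cadj Cw r.1 : Matrix S S ℝ) *ᵥ u) ⬝ᵥ f|
        ≤ (Option.elim p (Cl * (R1 * (Rinf + ‖f‖ + 1)))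
            fun r => Real.exp (-(c * rek / 2)) ^ r.1.card * ((r.1.card * sc : ℕ) : ℝ) * (R1 * (Rinf + ‖f‖ + 1)) : ℝ)
          * (Option.elim p 1 fun r => Real.exp (-(c * rek / 2)) ^ r.1.card : ℝ)) ∧
    (∀ p : Option {X : Finset K // Adm X}, ∀ u ∈ Dir,
      (∑ b ∈ Bs, |(ContinuousLinearMap.proj (y b) : (S → ℝ) →L[ℝ] ℝ)
        ((Option.elim p (cLoc ldist ρr Cw) fun r => cX ldist ρr cubeOf cadj Cw r.1 : Matrix S S ℝ) *ᵥ u)|)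
        ≤ (Option.elim p (Cl * (R1 * (Rinf + ‖f‖ + 1)))
            fun r => Real.exp (-(c * rek / 2)) ^ r.1.card * ((r.1.card * sc : ℕ) : ℝ) * (R1 * (Rinf + ‖f‖ + 1)) : ℝ)
          * (Option.elim p 1 fun r => Real.exp (-(c * rek / 2)) ^ r.1.card : ℝ)) ∧
    (∀ p : Option {X : Finset K // Adm X}, Option.isSome p = false →
      (Option.elim p (Cl * (R1 * (Rinf + ‖f‖ + 1)))
          fun r => Real.exp (-(c * rek / 2)) ^ r.1.card * ((r.1.card * sc : ℕ) : ℝ) * (R1 * (Rinf + ‖f‖ + 1)) : ℝ)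
        ≤ Bl ∧ (Option.elim p (∅ : Finset K) fun r => r.1) = ∅) ∧
    (∀ p : Option {X : Finset K // Adm X}, Option.isSome p = true →
      (Option.elim p (Cl * (R1 * (Rinf + ‖f‖ + 1)))
          fun r => Real.exp (-(c * rek / 2)) ^ r.1.card * ((r.1.card * sc : ℕ) : ℝ) * (R1 * (Rinf + ‖f‖ + 1)) : ℝ)
        ≤ θw * θ ^ (Option.elim p (∅ : Finset K) fun r => r.1).card) := by
  set Kw : ℝ := R1 * (Rinf + ‖f‖ + 1) with hKw
  have hKw0 : 0 ≤ Kw := mul_nonneg hR1 (by linarith [norm_nonneg f])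
  set lam : ℝ := Real.exp (-(c * rek / 2)) with hlam
  have hlam0 : 0 ≤ lam := (Real.exp_pos _).le
  -- the column-sum letters of the pieces
  set C₁ : Option {X : Finset K // Adm X} → ℝ := fun p => Option.elim p Cl
    fun r => Real.exp (-c * rek * (r.1.card : ℕ)) * ((r.1.card * sc : ℕ) : ℝ) with hC₁
  have hC0 : ∀ p, 0 ≤ C₁ p := by
    rintro (_ | r)
    · exact hCl0
    · exact mul_nonneg (Real.exp_pos _).le (Nat.cast_nonneg _)
  have hC : ∀ p yy, ∑ x, |(Option.elim p (cLoc ldist ρr Cw) fun r => cX ldist ρr cubeOf cadj Cw r.1 :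
      Matrix S S ℝ) x yy| ≤ C₁ p := by
    rintro (_ | r) yy
    · exact hCl yy
    · exact colsum_cX_le ldist ρr cubeOf cadj Cw inBlock cube h246 hblk hsc r.1 yy
  obtain ⟨hB, hBf, hBzN⟩ := letters_of_colsum Bs hy hC0 hC f hRinf hR1 hDir
  have hsq : ∀ m : ℕ, lam ^ m * lam ^ m = Real.exp (-c * rek * (m : ℕ)) := fun m => by
    rw [hlam, ← mul_pow, ← Real.exp_add, ← Real.exp_nat_mul]
    congr 1; ring
  have hprod : ∀ p : Option {X : Finset K // Adm X},
      (Option.elim p (Cl * Kw) fun r => lam ^ r.1.card * ((r.1.card * sc : ℕ) : ℝ) * Kw : ℝ)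
        * (Option.elim p 1 fun r => lam ^ r.1.card : ℝ) = C₁ p * Kw := by
    rintro (_ | r)
    · simp only [Option.elim, hC₁, mul_one]
    · simp only [Option.elim, hC₁]
      rw [← hsq]; ring
  refine ⟨?_, ?_, fun p u hu w hw => ?_, fun p u hu => ?_, fun p u hu => ?_, ?_, ?_⟩
  · rintro (_ | r)
    · exact mul_nonneg hCl0 hKw0
    · exact mul_nonneg (mul_nonneg (pow_nonneg hlam0 _) (Nat.cast_nonneg _)) hKw0
  · rintro (_ | r)
    · exact zero_le_one
    · exact pow_nonneg hlam0 _
  · rw [hprod]; exact hB p u hu w hw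
  · rw [hprod]; exact hBf p u hu
  · rw [hprod]; exact hBzN p u hu
  · rintro (_ | r) hp
    · exact ⟨hBl', rfl⟩
    · simp at hp
  · rintro (_ | r) hp
    · simp at hp
    · simp only [Option.elim]
      set m : ℕ := r.1.card with hm
      have ha : 1 ≤ c * rek / 4 := by linarith
      have hθ0 : 0 ≤ θ := (Real.exp_pos _).le.trans hθrek
      have hθw0 : 0 ≤ θw := le_trans (mul_nonneg (mul_nonneg (Real.exp_pos _).le (Nat.cast_nonneg _)) hKw0) hθw'
      have hlam2 : lam = Real.exp (-(c * rek / 4)) * Real.exp (-(c * rek / 4)) := by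
        rw [hlam, ← Real.exp_add]; congr 1; ring
      rcases Nat.eq_zero_or_pos m with hm0 | hmpos
      · rw [hm0]; simp only [pow_zero, Nat.cast_zero, zero_mul, mul_zero, mul_one]
        exact hθw0
      · have hq : Real.exp (-(c * rek / 4)) ^ m ≤ θ ^ m := pow_le_pow_left₀ (Real.exp_pos _).le hθrek m
        have hkey : Real.exp (-(c * rek / 4)) ^ m * (m : ℝ) ≤ Real.exp (-(c * rek / 4)) :=
          exp_neg_pow_mul_le ha hmpos
        calc lam ^ m * ((m * sc : ℕ) : ℝ) * Kw
            = θw * 0 + (Real.exp (-(c * rek / 4)) ^ m * (m : ℝ)) * (sc * Kw) * Real.exp (-(c * rek / 4)) ^ m := by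
              rw [hlam2, mul_pow]; push_cast; ring
          _ ≤ θw * 0 + Real.exp (-(c * rek / 4)) * (sc * Kw) * θ ^ m := by
              refine add_le_add le_rfl (mul_le_mul (mul_le_mul_of_nonneg_right hkey (by positivity)) hq
                (pow_nonneg (Real.exp_pos _).le _) ?_)
              exact mul_nonneg (Real.exp_pos _).le (by positivity)
          _ ≤ θw * 0 + θw * θ ^ m := by
              refine add_le_add le_rfl (mul_le_mul_of_nonneg_right ?_ (pow_nonneg hθ0 _))
              calc Real.exp (-(c * rek / 4)) * (sc * Kw) = Real.exp (-(c * rek / 4)) * sc * Kw := by ring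
                _ ≤ θw := hθw'
          _ = θw * θ ^ m := by ring

/-! ## §3  The instance: decay letter (2.41) plus a site-summability letter -/

/-- **THE SEVEN CLAUSE INPUTS WITH PRINT'S DECAY LETTER FOR `C_loc`**: `split245_letters_of_colsum` with
`C_ℓ := K₀·C_s` from a two-constant decay `|C_loc(x₁,x₂)| ≤ K₀e^{−c₁d(x₁,x₂)}` (*"bounded as in (2.41)"*; in [6]'s
setting p02's `BIJ88Decay241Walks.abs_cLoc_le_exp`) and the site-summability letter `Σ_x e^{−c₁d(x,y)} ≤ C_s`; the local
clause condition reads `K₀·C_s·R₁K_w ≤ B_ℓ` — free of `r(e_k)`.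
[cite: BalabanImbrieJaffe1988, (2.41), (2.43) p.264; §5.14 p.310, p.312] -/
theorem split245_letters_decay (ldist : J → S → ℝ) (ρr : ℝ) (cubeOf : J → K) (cadj : K → K → Prop)
    (Cw : Walk J → S → S → ℝ) (inBlock : S → J → Prop) (cube : S → K) (Adm : Finset K → Prop) {c rek : ℝ}
    (h246 : BIJ88Sect2Statements.Ineq246 (fun X : Finset K => X.card) (memX inBlock cubeOf cadj)
      (cX ldist ρr cubeOf cadj Cw) c rek)
    (hblk : ∀ x j, inBlock x j → cube x ∈ closure cadj {cubeOf j})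
    (sdist : S → S → ℝ) {K₀ c₁ Cs : ℝ} (hK0 : 0 ≤ K₀) (hCs0 : 0 ≤ Cs)
    (hdec : ∀ x₁ x₂, |cLoc ldist ρr Cw x₁ x₂| ≤ K₀ * Real.exp (-(c₁ * sdist x₁ x₂)))
    (hsum : ∀ y', ∑ x, Real.exp (-(c₁ * sdist x y')) ≤ Cs) {sc : ℕ}
    (hsc : ∀ k, (univ.filter fun x => cube x = k).card ≤ sc)
    {B : Type} (Bs : Finset B) {y : B → S} (hy : Set.InjOn y Bs) (f : S → ℝ)
    {Dir : Set (S → ℝ)} {Rinf R1 : ℝ} (hRinf : 0 ≤ Rinf) (hR1 : 0 ≤ R1)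
    (hDir : ∀ u ∈ Dir, ‖u‖ ≤ Rinf ∧ ∑ x, |u x| ≤ R1)
    {θ θw Bl : ℝ} (h4 : 4 ≤ c * rek) (hθrek : Real.exp (-(c * rek / 4)) ≤ θ)
    (hBl' : K₀ * Cs * (R1 * (Rinf + ‖f‖ + 1)) ≤ Bl)
    (hθw' : Real.exp (-(c * rek / 4)) * sc * (R1 * (Rinf + ‖f‖ + 1)) ≤ θw) :
    (∀ p : Option {X : Finset K // Adm X}, 0 ≤ (Option.elim p (K₀ * Cs * (R1 * (Rinf + ‖f‖ + 1)))
        fun r => Real.exp (-(c * rek / 2)) ^ r.1.card * ((r.1.card * sc : ℕ) : ℝ) * (R1 * (Rinf + ‖f‖ + 1)) : ℝ)) ∧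
    (∀ p : Option {X : Finset K // Adm X}, 0 ≤ (Option.elim p 1 fun r => Real.exp (-(c * rek / 2)) ^ r.1.card : ℝ)) ∧
    (∀ p : Option {X : Finset K // Adm X}, ∀ u ∈ Dir, ∀ w ∈ Dir,
      |((Option.elim p (cLoc ldist ρr Cw) fun r => cX ldist ρr cubeOf cadj Cw r.1 : Matrix S S ℝ) *ᵥ u) ⬝ᵥ w|
        ≤ (Option.elim p (K₀ * Cs * (R1 * (Rinf + ‖f‖ + 1)))
            fun r => Real.exp (-(c * rek / 2)) ^ r.1.card * ((r.1.card * sc : ℕ) : ℝ) * (R1 * (Rinf + ‖f‖ + 1)) : ℝ)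
          * (Option.elim p 1 fun r => Real.exp (-(c * rek / 2)) ^ r.1.card : ℝ)) ∧
    (∀ p : Option {X : Finset K // Adm X}, ∀ u ∈ Dir,
      |((Option.elim p (cLoc ldist ρr Cw) fun r => cX ldist ρr cubeOf cadj Cw r.1 : Matrix S S ℝ) *ᵥ u) ⬝ᵥ f|
        ≤ (Option.elim p (K₀ * Cs * (R1 * (Rinf + ‖f‖ + 1)))
            fun r => Real.exp (-(c * rek / 2)) ^ r.1.card * ((r.1.card * sc : ℕ) : ℝ) * (R1 * (Rinf + ‖f‖ + 1)) : ℝ)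
          * (Option.elim p 1 fun r => Real.exp (-(c * rek / 2)) ^ r.1.card : ℝ)) ∧
    (∀ p : Option {X : Finset K // Adm X}, ∀ u ∈ Dir,
      (∑ b ∈ Bs, |(ContinuousLinearMap.proj (y b) : (S → ℝ) →L[ℝ] ℝ)
        ((Option.elim p (cLoc ldist ρr Cw) fun r => cX ldist ρr cubeOf cadj Cw r.1 : Matrix S S ℝ) *ᵥ u)|)
        ≤ (Option.elim p (K₀ * Cs * (R1 * (Rinf + ‖f‖ + 1)))
            fun r => Real.exp (-(c * rek / 2)) ^ r.1.card * ((r.1.card * sc : ℕ) : ℝ) * (R1 * (Rinf + ‖f‖ + 1)) : ℝ)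
          * (Option.elim p 1 fun r => Real.exp (-(c * rek / 2)) ^ r.1.card : ℝ)) ∧
    (∀ p : Option {X : Finset K // Adm X}, Option.isSome p = false →
      (Option.elim p (K₀ * Cs * (R1 * (Rinf + ‖f‖ + 1)))
          fun r => Real.exp (-(c * rek / 2)) ^ r.1.card * ((r.1.card * sc : ℕ) : ℝ) * (R1 * (Rinf + ‖f‖ + 1)) : ℝ)
        ≤ Bl ∧ (Option.elim p (∅ : Finset K) fun r => r.1) = ∅) ∧
    (∀ p : Option {X : Finset K // Adm X}, Option.isSome p = true →
      (Option.elim p (K₀ * Cs * (R1 * (Rinf + ‖f‖ + 1)))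
          fun r => Real.exp (-(c * rek / 2)) ^ r.1.card * ((r.1.card * sc : ℕ) : ℝ) * (R1 * (Rinf + ‖f‖ + 1)) : ℝ)
        ≤ θw * θ ^ (Option.elim p (∅ : Finset K) fun r => r.1).card) :=
  split245_letters_of_colsum ldist ρr cubeOf cadj Cw inBlock cube Adm h246 hblk (mul_nonneg hK0 hCs0)
    (fun y' => colsum_le_of_decay _ sdist hK0 hdec hsum y') hsc Bs hy f hRinf hR1 hDir h4 hθrek hBl' hθw'

end Split

end Literature.MathematicalPhysics.QuantumFieldTheory.BalabanImbrieJaffe1984to88.BIJ88WalkSplit245LettersDecay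

end
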